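import Summits.AtomisticToContinuum.HydrodynamicLimit.Theorems.InfluenceLocality.Negative.KillCriterion
import Summits.AtomisticToContinuum.HydrodynamicLimit.Theorems.InfluenceLocality.Negative.Served

/-!
# `InfluenceLocality` (stmt-AtomisticToContinuum-13916) — both load-bearing claims from ONE
static estimate

Sorry-free §G (second half) of the standing disprover's work file
`Cruxes/InfluenceLocality/Disproof.lean` (refuter-cdisprove-stmt-AtomisticToContinuum-13916-0,
2026-08-16): `ServedSphereMass σ T R` (every sphere is served with `G_N`-probability
`≥ p(σ,T,R) > 0`, uniformly in `N`; an equilibrium statement about dilute hard spheres, NOT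
proved in the tree) implies the dynamical facts `CorruptionEvent` (so the slack `δ > 0` of the
crux is load-bearing, `withoutDelta_false_of_corruption`) and `PositiveBadFraction` (so the
order `lam` before `R` is load-bearing, `uniformInLam_false_of_positiveBadFraction`).
Nothing here asserts a Theses decl positively.
-/

namespace Summit.AtomisticToContinuum.HydrodynamicLimit.Theorems.InfluenceLocality.Negative

open MeasureTheory Set
open scoped Classical ENNReal
open Literature.Analysis.FluidPDE Literature.MathematicalPhysics.KineticTheory
open Summit.AtomisticToContinuum.HydrodynamicLimit.Theses.AntiMazurCoboundaries (InfluenceLocality)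

noncomputable section

section Reductions

/-- THE SINGLE STATIC INPUT: every sphere is served with probability `≥ p > 0`, uniformly in
`N ≥ N₀` (an equilibrium statement about the dilute hard-sphere Gibbs state; §E). -/
def ServedSphereMass (σ T R : ℝ) : Prop :=
  ∃ p : ℝ, 0 < p ∧ ∃ N₀ : ℕ, ∀ N : ℕ, N₀ ≤ N → ∀ (Φ : Flow σ N) (i : Fin (N + 1)),
    ENNReal.ofReal p ≤ gibbs σ 1 1 0 N Φ (Served σ T R N i)

/-- `ServedSphereMass ⇒ CorruptionEvent` (sphere `0` served ⇒ a bad sphere, on the good set). [folklore] -/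
theorem corruptionEvent_of_servedSphereMass {σ T R : ℝ} (hσ : 0 < σ) (hσ' : σ ≤ 1 / 4)
    (hT : 0 < T) (h : ServedSphereMass σ T R) : CorruptionEvent 1 1 0 σ T R := by
  obtain ⟨p, hp, N₀, hN⟩ := h
  refine ⟨ENNReal.ofReal p, ENNReal.ofReal_pos.2 hp, N₀, fun N hN₀ => ?_⟩
  obtain ⟨hε, hεσ⟩ := hsDiameter_pos_le hσ N
  have hε' : hsDiameter σ N < 2⁻¹ := hεσ.trans_lt (hσ'.trans_lt (by norm_num))
  refine ⟨alexanderFlow hε hε' (N + 1), fun k => alexanderFlow hε hε' k,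
    Served σ T R N 0 ∩ (alexanderFlow hε hε' (N + 1)).good,
    (measurableSet_served σ T R N 0).inter (alexanderFlow hε hε' (N + 1)).measurableSet_good, ?_, ?_⟩
  · rintro z ⟨hz, hzg⟩
    obtain ⟨j, hj0, hmem⟩ := mem_served_iff.1 hz
    rw [badCount_eq_card_badSet, Nat.one_le_iff_ne_zero, Ne, Finset.card_eq_zero,
      ← Ne, ← Finset.nonempty_iff_ne_empty]
    rcases mem_badSet_or_of_cappedAimedPair hT.le _ (singletonFree_alexander hε hε') hzg
      (Ne.symm hj0) hmem with h | h
    exacts [⟨0, h⟩, ⟨j, h⟩]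
  · rw [measure_inter_conull (gibbs_compl_good σ 1 1 0 N _)]
    exact hN N hN₀ _ 0

/-- `ServedSphereMass ⇒ PositiveBadFraction` (matching lemma + reverse Markov), with
`ε = q = p/2`. [folklore] -/
theorem positiveBadFraction_of_servedSphereMass {σ T R : ℝ} (hσ : 0 < σ) (hσ' : σ ≤ 1 / 4)
    (hT : 0 < T) (h : ServedSphereMass σ T R) : PositiveBadFraction 1 1 0 σ T R := by
  obtain ⟨p, hp, N₀, hN⟩ := h
  refine ⟨p / 2, by positivity, p / 2, by positivity, N₀, fun N hN₀ => ?_⟩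
  obtain ⟨hε, hεσ⟩ := hsDiameter_pos_le hσ N
  have hε' : hsDiameter σ N < 2⁻¹ := hεσ.trans_lt (hσ'.trans_lt (by norm_num))
  haveI : IsProbabilityMeasure (gibbs σ 1 1 0 N (alexanderFlow hε hε' (N + 1))) :=
    isProbabilityMeasure_gibbs 0 one_pos one_pos (hσ'.trans (by norm_num)) N _
  have hEm : MeasurableSet {z : Config (N + 1) (Fin 3) T3 |
      ENNReal.ofReal p / 2 * (Fintype.card (Fin (N + 1)) : ℝ≥0∞) ≤
        ∑ i, (Served σ T R N i).indicator (fun _ => (1 : ℝ≥0∞)) z} :=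
    measurableSet_le measurable_const
      (Finset.measurable_sum _ fun i _ => measurable_const.indicator (measurableSet_served σ T R N i))
  have hmass := measure_sum_indicator_ge (gibbs σ 1 1 0 N (alexanderFlow hε hε' (N + 1)))
    (fun i => measurableSet_served σ T R N i) (fun i => hN N hN₀ (alexanderFlow hε hε' (N + 1)) i)
  refine ⟨alexanderFlow hε hε' (N + 1), fun k => alexanderFlow hε hε' k,
    {z : Config (N + 1) (Fin 3) T3 | ENNReal.ofReal p / 2 * (Fintype.card (Fin (N + 1)) : ℝ≥0∞) ≤
        ∑ i, (Served σ T R N i).indicator (fun _ => (1 : ℝ≥0∞)) z} ∩ (alexanderFlow hε hε' (N + 1)).good,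
    ⌈p / 2 * ((N : ℝ) + 1)⌉₊, hEm.inter (alexanderFlow hε hε' (N + 1)).measurableSet_good,
    Nat.le_ceil _, ?_, ?_⟩
  · rintro z ⟨hzE, hzg⟩
    have h2 : ENNReal.ofReal p / 2 * (Fintype.card (Fin (N + 1)) : ℝ≥0∞) =
        ENNReal.ofReal (p / 2 * ((N : ℝ) + 1)) := by
      rw [Fintype.card_fin, ENNReal.ofReal_mul (by positivity : (0 : ℝ) ≤ p / 2),
        ENNReal.ofReal_div_of_pos two_pos, ENNReal.ofReal_ofNat]
      congr 1
      push_cast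
      rw [ENNReal.ofReal_add (by positivity) zero_le_one, ENNReal.ofReal_natCast, ENNReal.ofReal_one]
    have h1 : ENNReal.ofReal (p / 2 * ((N : ℝ) + 1)) ≤ ((servedSet σ T R N z).card : ℝ≥0∞) := by
      rw [← h2, ← sum_indicator_served_eq_card]
      exact hzE
    have h3 : ((servedSet σ T R N z).card : ℝ≥0∞) =
        ENNReal.ofReal ((servedSet σ T R N z).card : ℝ) := by rw [ENNReal.ofReal_natCast]
    rw [h3, ENNReal.ofReal_le_ofReal_iff (Nat.cast_nonneg _)] at h1
    calc ⌈p / 2 * ((N : ℝ) + 1)⌉₊ ≤ (servedSet σ T R N z).card := Nat.ceil_le.2 h1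
      _ ≤ _ := card_servedSet_le_badCount hT.le _ (singletonFree_alexander hε hε') hzg
  · rw [measure_inter_conull (gibbs_compl_good σ 1 1 0 N _), ENNReal.ofReal_div_of_pos two_pos,
      ENNReal.ofReal_ofNat]
    exact hmass

end Reductions

end

end Summit.AtomisticToContinuum.HydrodynamicLimit.Theorems.InfluenceLocality.Negative
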